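import Summits.Ventures.Crystal3D.Theorems.StickyWulffConstantCoaxialWallLawTriadicRegistryCoaxial
import Summits.Ventures.Crystal3D.Theorems.StickyWulffConstantCoaxialWallLawWallLedgerFDefs
import HarnessLib

/-!
# Lane F's debt statement of record after the triadic registry: `CoaxialWallLaw` ⇐ {E1, `StarPairFar`, the TRIADIC CORE}
# (crux `CoaxialWallLaw`, stmt-Ventures-19481, line `WallLedgerF`)

HONEST FRAMING. Venture `Summits/Ventures/Crystal3D` (cell `crystal3d-full`), helper `--supports` the crux
`CoaxialWallLaw` of `route-Ventures-StickyWulffConstant` (REGISTERED line `WallLedgerF`, open stub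
`stub_coaxialTwoSlabAdhesion`).  Book-keeping only; rung credit; F-C1 not moved; NOT the crux: the TRIADIC CORE defined
here is exactly what remains open (the census of coherent fault/Shockley-coset staircases and two-partial cosets with
arbitrary fillings), and `ExactOnly`(C12-55) [E1, certified; `P5Exhaustion`] / `StarPairFar` [certified; kernel at
computational grade, `StarFar.starPairFar_holds`] stay BY NAME.

* `CoaxialTwoSlabAdhesionTriadic` — the registered stub `CoaxialTwoSlabAdhesion` (…WallLedgerFDefs) RESTRICTED to pairs
  whose offset is TRIADIC over grain 1: `3^j · A₁⁻¹(t₂ − t₁) ∈ Λ₀` for some `j` (cubic coordinates in `ℤ[1/3]`, even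
  sum).  `coaxialTwoSlabAdhesionTriadic_of_stub`: the stub implies it (nothing smuggled).
* **`coaxialTwoSlabAdhesion_of_triadic`** — E1 (as `ExactOnly` of a slot star) + `StarPairFar` + the triadic core ⇒ the
  stub `CoaxialTwoSlabAdhesion` IN FULL: non-triadic pairs are free by `coaxialTwoSlabAdhesion_of_not_triadic`
  (`…TriadicRegistryCoaxial`: off the registry set of lane G's stack walkers, charge `1 ≥ ½ sin θ`).
* the crux BY NAME (`coaxialWallLaw_of_triadic`, `coaxialWallLaw_of_p5_triadic`) is in the leaf capstone
  `…CoaxialWallLawTriadicCoreCapstone` (it needs the route file through `coaxialWallLaw_of_stubProps`; this file is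
  route-independent).
So lane F's open set is, provably, the TRIADIC co-axial pairs with arbitrary fillings — nothing else.
WHAT THIS IS NOT: a proof of the core; F-C1 not moved.
-/

noncomputable section

namespace Summit.Ventures.Crystal3D.Theorems

open Summit.Ventures.Crystal3D Finset
open Summit.Ventures.Crystal3D.Cruxes.CoaxialWallLaw.WallLedgerF (AffineSampleDeficit CoaxialTwoSlabAdhesion)
open Literature.MathematicalPhysics.StatisticalMechanics (fccStacking barlowStacking IsHaggSeq contactDeficiency)
open scoped InnerProductSpace

/-- **The TRIADIC CORE of lane F**: the registered stub `CoaxialTwoSlabAdhesion` restricted to co-axial pairs whose offset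
is triadic over grain 1 (`3^j · A₁⁻¹(t₂ − t₁) ∈ Λ₀` for some `j`) — the coherent fault/Shockley cosets and the two-partial
cosets, where the terrace/riser census lives. -/
def CoaxialTwoSlabAdhesionTriadic : Prop :=
    ∀ (A₁ : EuclideanSpace ℝ (Fin 3) ≃ₗᵢ[ℝ] EuclideanSpace ℝ (Fin 3)) (t₁ : EuclideanSpace ℝ (Fin 3))
      (A₂ : EuclideanSpace ℝ (Fin 3) ≃ₗᵢ[ℝ] EuclideanSpace ℝ (Fin 3)) (t₂ : EuclideanSpace ℝ (Fin 3)),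
    (∃ (L : EuclideanSpace ℝ (Fin 3) ≃ₗᵢ[ℝ] EuclideanSpace ℝ (Fin 3))
        (s₁ s₂ : EuclideanSpace ℝ (Fin 3)) (σ σ' : ℤ → ℤ), IsHaggSeq σ ∧ IsHaggSeq σ' ∧
        (fun p => A₁ p + t₁) '' fccStacking 1 (Real.sqrt (2 / 3)) ⊆
          (fun p => L p + s₁) '' barlowStacking 1 (Real.sqrt (2 / 3)) σ ∧
        (fun p => A₂ p + t₂) '' fccStacking 1 (Real.sqrt (2 / 3)) ⊆
          (fun p => L p + s₂) '' barlowStacking 1 (Real.sqrt (2 / 3)) σ') →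
    (fun p => A₁ p + t₁) '' fccStacking 1 (Real.sqrt (2 / 3)) ≠
      (fun p => A₂ p + t₂) '' fccStacking 1 (Real.sqrt (2 / 3)) →
    (∃ j : ℕ, ((3 : ℝ) ^ j) • A₁.symm (t₂ - t₁) ∈ fccStacking 1 (Real.sqrt (2 / 3))) →
    ∃ (L : EuclideanSpace ℝ (Fin 3) ≃ₗᵢ[ℝ] EuclideanSpace ℝ (Fin 3))
        (s₁ s₂ : EuclideanSpace ℝ (Fin 3)) (σ σ' : ℤ → ℤ), IsHaggSeq σ ∧ IsHaggSeq σ' ∧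
        (fun p => A₁ p + t₁) '' fccStacking 1 (Real.sqrt (2 / 3)) ⊆
          (fun p => L p + s₁) '' barlowStacking 1 (Real.sqrt (2 / 3)) σ ∧
        (fun p => A₂ p + t₂) '' fccStacking 1 (Real.sqrt (2 / 3)) ⊆
          (fun p => L p + s₂) '' barlowStacking 1 (Real.sqrt (2 / 3)) σ' ∧
    ∃ C R₀ : ℝ, 1 ≤ R₀ ∧ ∀ h : ℝ, 0 ≤ h → ∀ ρ : ℝ, R₀ ≤ ρ →
      ∀ X P₁ P₂ : Finset (EuclideanSpace ℝ (Fin 3)),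
      (∀ p ∈ X, ∀ q ∈ X, p ≠ q → 1 ≤ dist p q) → P₁ ⊆ X → P₂ ⊆ X \ P₁ →
      (∀ p ∈ X, -(2 * R₀) ≤ p 2 ∧ p 2 ≤ h + 2 * R₀ ∧ p 0 ^ 2 + p 1 ^ 2 ≤ ρ ^ 2) →
      (∀ p, p ∈ P₁ ↔ (p ∈ (fun q => A₁ q + t₁) '' fccStacking 1 (Real.sqrt (2 / 3)) ∧
        -(2 * R₀) ≤ p 2 ∧ p 2 ≤ -R₀ ∧ p 0 ^ 2 + p 1 ^ 2 ≤ ρ ^ 2)) →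
      (∀ p, p ∈ P₂ ↔ (p ∈ (fun q => A₂ q + t₂) '' fccStacking 1 (Real.sqrt (2 / 3)) ∧
        h + R₀ ≤ p 2 ∧ p 2 ≤ h + 2 * R₀ ∧ p 0 ^ 2 + p 1 ^ 2 ≤ ρ ^ 2)) →
      ((((P₁ ×ˢ (X \ P₁)).filter fun pq => dist pq.1 pq.2 = 1).card : ℕ) : ℝ) +
        ((((P₂ ×ˢ ((X \ P₁) \ P₂)).filter fun pq => dist pq.1 pq.2 = 1).card : ℕ) : ℝ) ≤
        contactDeficiency ((X \ P₁) \ P₂) +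
          (Real.sqrt 2 / 4 * ∑ᶠ w ∈ {w ∈ fccStacking 1 (Real.sqrt (2 / 3)) | ‖w‖ = 1},
              |⟪w, A₁.symm (EuclideanSpace.single (2 : Fin 3) (1 : ℝ))⟫_ℝ| +
            Real.sqrt 2 / 4 * ∑ᶠ w ∈ {w ∈ fccStacking 1 (Real.sqrt (2 / 3)) | ‖w‖ = 1},
              |⟪w, A₂.symm (EuclideanSpace.single (2 : Fin 3) (1 : ℝ))⟫_ℝ| -
            (1 / 2 : ℝ) * Real.sqrt (1 - ⟪L (EuclideanSpace.single (2 : Fin 3) (1 : ℝ)),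
              (EuclideanSpace.single (2 : Fin 3) (1 : ℝ))⟫_ℝ ^ 2)) * Real.pi * ρ ^ 2 +
          C * (1 + h) * ρ

/-- Nothing is smuggled: the registered stub implies its triadic restriction. -/
theorem coaxialTwoSlabAdhesionTriadic_of_stub (h : CoaxialTwoSlabAdhesion) : CoaxialTwoSlabAdhesionTriadic :=
  fun A₁ t₁ A₂ t₂ hco hne _ => h A₁ t₁ A₂ t₂ hco hne

open scoped Classical in
/-- **The registered stub `CoaxialTwoSlabAdhesion` IN FULL from E1, `StarPairFar` and the triadic core**: pairs with a
non-triadic offset are free (`coaxialTwoSlabAdhesion_of_not_triadic`), the rest is the core. -/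
theorem coaxialTwoSlabAdhesion_of_triadic
    {s₀ : EuclideanSpace ℝ (Fin 3)} (hs₀ : s₀ ∈ fccSlots)
    (hcert : ExactOnly 0 (fccSlots.filter fun w => 0 < ⟪w, s₀⟫_ℝ)) (hfar : StarPairFar)
    (hcore : CoaxialTwoSlabAdhesionTriadic) : CoaxialTwoSlabAdhesion := by
  intro A₁ t₁ A₂ t₂ hco hne
  by_cases ht : ∃ j : ℕ, ((3 : ℝ) ^ j) • A₁.symm (t₂ - t₁) ∈ fccStacking 1 (Real.sqrt (2 / 3))
  · exact hcore A₁ t₁ A₂ t₂ hco hne ht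
  · exact coaxialTwoSlabAdhesion_of_not_triadic hs₀ hcert hfar A₁ t₁ A₂ t₂ hco ht

end Summit.Ventures.Crystal3D.Theorems

end
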